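import Summits.NavierStokesRegularity.NavierStokesRegularity.Theorems.SymmetricScarExists.Negative.SpiralWorld

/-!
# `SymmetricScarExists` (crux stmt-NavierStokesRegularity-11718, route RellichScar): the repaired
# assembly — negative-side support, part 2 (cdisprove seat)

Continuation of `Negative/SpiralWorld.lean` (the omitted rotated-self-similar symmetry class;
Pineau–Vicol 2026, arXiv:2607.09619).  Proved here, `sorry`-free:

* `not_scarRigidity_of_rss_axiScar` — a singular apex `α`-RSS profile with EQUIVARIANT pattern
  (axisymmetric scar, hence homogeneous scar) refutes the sibling crux `ScarRigidity` given the
  provable supports `SimilarityCovariance` and `SelfSimilarApexFatal`; together with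
  `not_symmetricScarExists_of_spiral_world` (part 1): a Type-I RSS profile (Perelman's open scenario)
  sinks the route through `ScarRigidity` if its pattern is equivariant and through the crux otherwise;
* `RssApexFatal α` — the third Fatal support the repaired crux `SymmetricScarExistsSpiral` needs
  (a singular apex profile is not a.e. `α`-RSS; `α = 0` is literally `SelfSimilarApexFatal`,
  `rssApexFatal_zero_iff`), and `noApexTypeIProfile_of_repaired` — the repaired assembly
  `ScarRigidity → SymmetricScarExistsSpiral → SimilarityCovariance → (∀ α, RssApexFatal α) →
  AxisymmetricApexFatal → NoApexTypeIProfile` is sound: the repair costs exactly one named open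
  problem (Perelman's Conjecture 1.1 in apex form) and nothing else.

## References

* B. Pineau, V. Vicol, arXiv:2607.09619 (2026): §1.2, Conjecture 1.1, Theorem 1.4. [PineauVicol2026]
-/

noncomputable section

open MeasureTheory Set Function Filter Topology TopologicalSpace Metric
open scoped NNReal ENNReal

namespace Summit.NavierStokesRegularity.NavierStokesRegularity.Theorems.SymmetricScarExists.Negative

open Literature.Analysis.FluidPDE
open Summit.NavierStokesRegularity.NavierStokesRegularity.Theses.RellichScar


/-- **An RSS singular apex profile with EQUIVARIANT pattern refutes `ScarRigidity`** (given the two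
provable supports `SimilarityCovariance`, `SelfSimilarApexFatal`): its scar is axisymmetric, hence
homogeneous (`homScar_iff_axiScar_of_isSpiralRSS`), so `ScarRigidity` identifies the profile with
all its rescalings and Tsai's theorem (inside `SelfSimilarApexFatal`) yields `False`.  Together with
`not_symmetricScarExists_of_spiral_world`: a Type-I RSS profile (Perelman's open scenario, P–V
Conj. 1.1) sinks the route through `ScarRigidity` if its pattern is equivariant and through the crux
otherwise. [cite: PineauVicol2026, Conjecture 1.1 (arXiv:2607.09619 p. 3)] -/
theorem not_scarRigidity_of_rss_axiScar {α : ℝ} (hα : α ≠ 0) (hCov : SimilarityCovariance)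
    (hSS : SelfSimilarApexFatal)
    (hex : ∃ (C : ℝ) (u : ℝ → (EuclideanSpace ℝ (Fin 3)) → (EuclideanSpace ℝ (Fin 3))) (p : ℝ → (EuclideanSpace ℝ (Fin 3)) → ℝ) (G : ℝ → (EuclideanSpace ℝ (Fin 3)) → (EuclideanSpace ℝ (Fin 3)) →L[ℝ] (EuclideanSpace ℝ (Fin 3))),
      IsSuitableWeakSolutionOn (slab (EuclideanSpace ℝ (Fin 3)) (Iio (0 : ℝ)) isOpen_Iio) 1 0 u p ∧ HasWeakSpatialGradientOn (slab (EuclideanSpace ℝ (Fin 3)) (Iio (0 : ℝ)) isOpen_Iio) u G ∧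
      typeIBound (Iio (0 : ℝ) ×ˢ univ) u p G < ⊤ ∧ HasTypeIDecay C u ∧
      IsBackwardSingularPoint u 0 ∧ IsSpiralRSS α u ∧ AxiScar u) :
    ¬ ScarRigidity := by
  intro hSR
  obtain ⟨C, u, p, G, hsw, hwg, hI, hdec, hsing, hRSS, hAxi⟩ := hex
  have hHom : HomScar u := (homScar_iff_axiScar_of_isSpiralRSS hα hRSS).2 hAxi
  refine hSS u p G C hsw hwg hI hdec hsing fun lam hlam => ?_
  obtain ⟨q, H, hs₁, hg₁, hI₁, hd₁, hsing₁⟩ := (hCov u p G C hsw hwg hI hdec hsing).1 lam hlam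
  exact hSR _ q H u p G C hs₁ hg₁ hI₁ hd₁ hsw hwg hI hdec hsing₁ hsing (hHom lam hlam)


/-- **The third Fatal support the repaired crux needs** — Perelman's conjecture in apex-class form,
generalising `SelfSimilarApexFatal` (`α = 0`): a singular apex profile cannot be a.e. `α`-RSS, i.e.
cannot satisfy `R_{2α log λ} D_λ u = u` a.e. on the slab for every `λ > 0`.  OPEN for `α ≈ 1`
(Pineau–Vicol 2026 Conj. 1.1; Thm 1.4 = tree fact `pineauVicol2026_rss_liouville` gives
`|α| < α₁(C)` and `|α| > α₂(C)` for classical RSS solutions). -/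
def RssApexFatal (α : ℝ) : Prop :=
  ∀ (u : ℝ → (EuclideanSpace ℝ (Fin 3)) → (EuclideanSpace ℝ (Fin 3))) (p : ℝ → (EuclideanSpace ℝ (Fin 3)) → ℝ) (G : ℝ → (EuclideanSpace ℝ (Fin 3)) → (EuclideanSpace ℝ (Fin 3)) →L[ℝ] (EuclideanSpace ℝ (Fin 3))) (C : ℝ),
    IsSuitableWeakSolutionOn (slab (EuclideanSpace ℝ (Fin 3)) (Iio (0 : ℝ)) isOpen_Iio) 1 0 u p → HasWeakSpatialGradientOn (slab (EuclideanSpace ℝ (Fin 3)) (Iio (0 : ℝ)) isOpen_Iio) u G →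
    typeIBound (Iio (0 : ℝ) ×ˢ univ) u p G < ⊤ → HasTypeIDecay C u → IsBackwardSingularPoint u 0 →
    (∀ lam : ℝ, 0 < lam →
      uncurry (conjZ (2 * α * Real.log lam) (nsRescale lam u)) =ᵐ[volume.restrict (Iio (0 : ℝ) ×ˢ univ)]
        uncurry u) → False

/-- At pitch `0`, `RssApexFatal 0` is literally `SelfSimilarApexFatal`. [folklore] -/
theorem rssApexFatal_zero_iff : RssApexFatal 0 ↔ SelfSimilarApexFatal := by
  unfold RssApexFatal
  simp only [mul_zero, zero_mul, conjZ_zero]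
  rfl

/-- **The repaired assembly is sound** (planner-facing): `ScarRigidity`, the REPAIRED crux
`SymmetricScarExistsSpiral`, `SimilarityCovariance`, the axisymmetric Fatal support and the spiral
Fatal supports `RssApexFatal α` for all `α` (`α = 0` being `SelfSimilarApexFatal`) imply the target
`NoApexTypeIProfile` — by the same lines as the route's `closes`: a spiral-scar profile has, for each
`λ`, the apex profile `R_{2α log λ} D_λ u` (two uses of covariance) with the same scar, which
`ScarRigidity` identifies with `u`; so `u` is a.e. `α`-RSS and `RssApexFatal α` ends it.  Hence the
repair costs exactly one new named open problem (Perelman's conjecture in apex form) and nothing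
else. [cite: PineauVicol2026, Conjecture 1.1 (arXiv:2607.09619 p. 3)] -/
theorem noApexTypeIProfile_of_repaired (hSR : ScarRigidity) (hZ : SymmetricScarExistsSpiral)
    (hCov : SimilarityCovariance) (hRss : ∀ α : ℝ, RssApexFatal α) (hAx : AxisymmetricApexFatal) :
    NoApexTypeIProfile := by
  intro u p G C hsw hwg hI hdec hsing
  obtain ⟨C', z, pz, Gz, hsz, hgz, hIz, hdz, hsingz, hsym⟩ := hZ C ⟨u, p, G, hsw, hwg, hI, hdec, hsing⟩
  rcases hsym with ⟨α, hspiral⟩ | hax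
  · refine hRss α z pz Gz C' hsz hgz hIz hdz hsingz fun lam hlam => ?_
    -- the rescaled profile, then its rotation-conjugate, stay in the apex class with the same constant
    obtain ⟨q₁, H₁, hs₁, hg₁, hI₁, hd₁, hsing₁⟩ := (hCov z pz Gz C' hsz hgz hIz hdz hsingz).1 lam hlam
    obtain ⟨q₂, H₂, hs₂, hg₂, hI₂, hd₂, hsing₂⟩ :=
      (hCov (nsRescale lam z) q₁ H₁ C' hs₁ hg₁ hI₁ hd₁ hsing₁).2 (2 * α * Real.log lam)
    exact hSR _ q₂ H₂ z pz Gz C' hs₂ hg₂ hI₂ hd₂ hsz hgz hIz hdz hsing₂ hsingz (hspiral lam hlam)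
  · refine hAx z pz Gz C' hsz hgz hIz hdz hsingz fun θ => ?_
    obtain ⟨q₁, H₁, hs₁, hg₁, hI₁, hd₁, hsing₁⟩ := (hCov z pz Gz C' hsz hgz hIz hdz hsingz).2 θ
    exact hSR _ q₁ H₁ z pz Gz C' hs₁ hg₁ hI₁ hd₁ hsz hgz hIz hdz hsing₁ hsingz (hax θ)



end Summit.NavierStokesRegularity.NavierStokesRegularity.Theorems.SymmetricScarExists.Negative
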